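import Literature.MathematicalPhysics.QuantumFieldTheory.Balaban1983to89.B9Eq365RemainderKernel
import Literature.MathematicalPhysics.QuantumFieldTheory.Balaban1983to89.B9Thm34SectBUniform

/-!
# `Balaban1983to89.B9Eq365RemainderKernelUniform` — [Balaban1985BackgroundPropagators] p. 403, L7–9: «This allows us to formulate a statement
# concerning the remainders G′(U)V′(A)G′(U′U) and G′(U′U)V′(A)G′(U) in (3.65). They satisfy Theorem 3.1 with the additional small factor O(1)α₁.»
# — the four (3.42) kernel entries of `G′(U′U) − G′(U)` with the factor `α₁` AND THE CONSTANTS CHOSEN BEFORE THE LATTICE: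
# `∃ a₁ > 0 ∃ B ∀ (T_η, k, {Ω_j}, U, …) ∀ α₁ ≦ a₁ ∀ A` (FILE 50 of the Sect. B programme of cell `lit-balaban`, seat r06 gen 21; FILE 32 re-quantified)

statement-level skeleton of published theorems with citation tags; proofs where landed; nothing here is a claim about the Yang–Mills mass gap

CITATION HEADER (lean-in-tree rule).  B9 = T. Bałaban, *Propagators for lattice gauge theories in a background field*, Commun. Math. Phys.
**99** (1985) 389–434 [Balaban1985BackgroundPropagators] (held `paper:balaban1985-cmp99-background-propagators`; journal page = PDF page + 388):
p. 402 [PDF 14] (3.65) «G′(U′U) = G′(U) + G′(U)V′(A)G′(U′U) = G′(U) + G′(U′U)V′(A)G′(U)»; p. 403 [PDF 15] L2–9 «Now applying Theorem 3.1 for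
G′(U), the bound (3.63), the representation (3.64) and Lemma 2.1 of [4] we can prove all the statements (3.42)–(3.47) of Theorem 3.1 for the
operator G′(U′U), of course with different constants, although changes are small. We define new constants in such a way that the statements
of Theorem 3.1 hold for extended operators. This allows us to formulate a statement concerning the remainders G′(U)V′(A)G′(U′U) and
G′(U′U)V′(A)G′(U) in (3.65). They satisfy Theorem 3.1 with the additional small factor O(1)α₁.»; Theorem 3.4 p. 400 [PDF 12] L7–10 «There
exists a positive constant a₁ such that the operators G′(U), (Q′(U)G′²(U)Q′*(U))⁻¹, R(U), G(U) extend to configurations U′U for α₁ ≦ a₁ as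
analytic functions of A. The extended operators satisfy all the inequalities of Theorems 3.1–3.3 correspondingly»; Theorem 3.1 p. 397 [PDF 9]
«There exist positive constants M₁, δ₀, a₀, B₀ dependent on d and L only» and (3.42) (the printed KERNEL shape = `B6RandomWalkKernel.HasKernelBound`,
kernels for the pairing of p. 393, block volume weight `v(y′) = (L^{j′}η)^d`); p. 399 [PDF 11] L1–3 «Let us stress that the constants in the
formulations of both theorems do not depend on the sequence {Ω_j}, j = 0, 1, …, k, if the conditions (2.1), (2.2) are satisfied»; (3.63) p. 402;
p. 398 remark after (3.47) (scale transfer); (3.19)/(3.24) pp. 393–394; (3.59) p. 402; (3.37) p. 396.  [4] = [Balaban1984PropagatorsII] T. Bałaban,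
*Propagators and renormalization transformations for lattice gauge theories. II*, Commun. Math. Phys. **96** (1984) 223–250: Lemma 2.1 p. 234
[PDF 12] (no dependence on the torus, k or {Ω_j}), (2.51)–(2.55) p. 232, (2.66) p. 234.  Rows B9.Eq3.62 ((3.62)–(3.65)) × B9.Thm3.4 × B9.Thm3.1
(cells only; no row head changes).

WHY THIS FILE (B9-CLOSURE §3 item 4, §5 item 2 (M); FILE 32 HONEST SCOPE (iv) «`a₁`, `B` packaged existentially after the lattice is fixed»;
INTERFACES-r06 §46/§47 RECIPE).  FILE 32 states the `α₁`-carrying (3.65) remainder in the printed kernel form as `∀ (lattice, background,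
letters) ∃ a₁ ∃ B ∀ α₁ ∀ A`; its proof computes `a₁` and `B` from lattice-free quantities only ([4] Lemma 2.1's `c₁(d; δ₀, 1/100)`, the p. 398
scale-transfer constant at exponent `1/100`, `|κ|`, `M₂Σ_i‖b_i‖`, `B_G`, `C_q`, `a₀`, `δ₀`, `d₀`, FILE 26's threshold/constant) — except that the
scale-transfer constant came from the per-lattice hypothesis `∃ Λ ≧ 1`.  Here (as in FILES 45–49) the p. 398 / [4] Lemma 2.1 scale transfer is
hypothesised in its printed uniform form (ONE function `Λ : (0,∞) → [1,∞)` for the family) and the quantifiers are re-ordered.  This is the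
`α₁`-carrying right letter `(G′(U′U) − G′(U))·Y` of the kernel forms of (3.66)/(3.68) (FILE 33) — needed in uniform form by the uniform twins of
FILES 33/31 (successor files of this gen).

WHAT IS PROVED (1 theorem: 0 `def`, 0 sorry, 0 new named facts; standard axioms).
* **`remainder365_kernel_uniform`** — FILE 32 `remainder365_kernel_final` (with `E := G′(U′U) = gPrimeExtEnd G′(U) (V′(A)G′(U))`: BOTH
  REMAINDERS OF (3.65) EQUAL `E − G′(U)` (`G′(U)·V′(A)·E = E − G′(U)`, `E·V′(A)·G′(U) = E − G′(U)`) AND the four (3.42) entries of `E − G′(U)` in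
  the printed kernel form WITH THE FACTOR `α₁`: `|(E − G′)(x,x′)| ≦ Bα₁(Lʲη)²e^{−(4δ₀/5)d}v(y′)⁻¹`, `|(∇_k(E − G′))(x,x′)|, |((E − G′)∇*_l)(x,x′)| ≦
  Bα₁Lʲη e^{−(4δ₀/5)d}v⁻¹`, `|(∇_k(E − G′)∇*_l)(x,x′)| ≦ Bα₁e^{−(4δ₀/5)d}v⁻¹`) with the quantifier order `∃ a₁ > 0 ∃ B ≧ 0 ∀ S T U g blk kQ sQ
  cfun w (axioms, [4] Lemma 2.1, scale transfer with the GIVEN Λ(·), (3.19)/(3.24)/(3.60) data, Theorem 3.1 for G′(U) = (Δ′_a(U))⁻¹ as block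
  majorants (3.42)₁₋₃ AND as kernel bounds (3.42)₁₋₄ with the pairing weights v, c_K) ∀ α₁ ≦ a₁ ∀ A kF sF …` — hypotheses inside the `∀` =
  FILE 32's VERBATIM (named binders), less `hrepr` (moved before) and with `hST` in the uniform form.  `a₁ = min(a₁⁽⁴⁵⁾, ε/2, 1/4)` with `ε` the
  continuity threshold below which `κ(α₁) ≦ K` for `θ₃₆₃(α₁) = κ(α₁)·α₁` (`κ = κ₃₈₅(B_G, c_V(α₁), 0, 0, Λ(1/100), c₁(δ₀,1/100))`);
  `B = B⁽⁴⁵⁾·K·Λ(1/100)·c₁(δ₀, 1/100)`.  (FILE 32's per-lattice statement follows by instantiation with `Λf := fun _ => Λ`.)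

PROOF.  FILE 32's proof verbatim after the re-ordering: FILE 45 `B9Thm34SectBUniform.thm34_Gp_uniform` (instead of FILE 26 `thm34_Gp_final`) and
FILE 25's `exists_bound_of_continuousAt` are invoked BEFORE the lattice is introduced; inside, FILE 45's `∀`-clause is applied to the lattice data
(`replace hfin := hfin T U blk …`), the two remainders are identified with `E − G′(U)` by the inverse identities
(`B9Ineq385KernelConcrete.eq386_resolvent_of_inverses`, `Δ′_a(U)G′(U) = 1 = G′(U)Δ′_a(U)`), the four words `X·(E − G′(U))·Y = (X·E)·(V′(A)·(G′(U)·Y))`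
get their kernels from FILE 45's left clause (block majorant of `X·E` at `9δ₀/10`) × FILE 29 §1 `ineq363_kernel_vPrime` ((3.63) with the
kernel on the right letter, rate `49δ₀/50`) by FILE 22's `B9Ineq385Kernel.hasKernelBound_comp_decay` ([4] (2.52)/(2.55) + Lemma 2.1 at exponent
`1/100` read from `Λ(1/100)`).

HONEST SCOPE / NOT CLAIMED.  As FILE 32: Theorem 3.1 FOR `U` is the INPUT (block-majorant and kernel form); only the four sup/kernel members
(3.42) of «Theorem 3.1 with the additional small factor O(1)α₁» are given (the Hölder/L²/global members are FILES 34–44's business); the rate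
`4δ₀/5` and the exponent `1/100` are ONE admissible bookkeeping of «of course with different constants» (p. 403); (3.37) read blockwise; the
uniformity displayed is uniformity in `(S, T, 𝔅, blk)`, `U`, the operators, the letters and the kernel weights `(v, c_K)` AT FIXED input
constants `(δ₀, B_G, C_q, a₀, d₀, M₂, Λ(·))`, `κ`, `(𝔸, b)` — the print's «dependent on d and L only» is this composed with Theorem 3.1's own
uniformity and [4] Lemma 2.1; analyticity in `A` = the finite-lattice algebra of (3.64).  NOT summit progress.

RELATED IN THE TREE, NOT DUPLICATED (searched 2026-08-23: `lean search 'remainder365_kernel_uniform' --decl` = ∅): FILE 32 `B9Eq365RemainderKernel`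
(`remainder365_kernel_final`, per-lattice), FILE 29 `B9Thm34GpKernelFinal.ineq363_kernel_vPrime`, FILE 45 `B9Thm34SectBUniform.thm34_Gp_uniform`,
FILE 25 `B9Thm34GKernelFinal.exists_bound_of_continuousAt`, FILE 22 `B9Ineq385Kernel.hasKernelBound_comp_decay`,
`B9Ineq385KernelConcrete.eq386_resolvent_of_inverses` — all USED BY NAME; no existing module modified.  Sibling this gen: FILE 49
`B9Thm34GpKernelUniform` (the `G′(U′U)` kernel clause itself, uniform).
-/

noncomputable section

namespace Literature.MathematicalPhysics.QuantumFieldTheory.Balaban1983to89.B9Eq365RemainderKernelUniform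

open NormedSpace Complex
open Literature.MathematicalPhysics.QuantumFieldTheory.Balaban1983to89
open Literature.MathematicalPhysics.QuantumFieldTheory.Balaban1983to89.B6RandomWalk (HasMajorant hasMajorant_mono Triangle254 Ineq261)
open Literature.MathematicalPhysics.QuantumFieldTheory.Balaban1983to89.B6RandomWalkKernel (HasKernelBound hasKernelBound_mono)
open Literature.MathematicalPhysics.QuantumFieldTheory.Balaban1983to89.B9Thm34Ext (toB6)
open Literature.MathematicalPhysics.QuantumFieldTheory.Balaban1983to89.B9Ineq347 (ScaleTransfer)
open Literature.MathematicalPhysics.QuantumFieldTheory.Balaban1983to89.B9Ineq385VG (kappa385 kappa385_nonneg)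
open Literature.MathematicalPhysics.QuantumFieldTheory.Balaban1983to89.B9Eq39Adjoint (covD covDstar)
open Literature.MathematicalPhysics.QuantumFieldTheory.Balaban1983to89.B9Eq352DivForm (tauB)
open Literature.MathematicalPhysics.QuantumFieldTheory.Balaban1983to89.B9Eq352DivFormLetters (conj)
open Literature.MathematicalPhysics.QuantumFieldTheory.Balaban1983to89.B9Eq352GradLetters (diffLetter)
open Literature.MathematicalPhysics.QuantumFieldTheory.Balaban1983to89.B9Eq360Vprime (gPrimeExtEnd)
open Literature.MathematicalPhysics.QuantumFieldTheory.Balaban1983to89.B9Eq360VprimeLetters (vPrimeConc cBConc)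
open Literature.MathematicalPhysics.QuantumFieldTheory.Balaban1983to89.B9Ineq363Vprime (cVConc cVConc_nonneg theta363 theta363_nonneg)
open Literature.MathematicalPhysics.QuantumFieldTheory.Balaban1983to89.B9Ineq385Kernel (hasKernelBound_rate_mono hasKernelBound_comp_decay)
open Literature.MathematicalPhysics.QuantumFieldTheory.Balaban1983to89.B9Ineq385KernelConcrete (eq386_resolvent_of_inverses)
open Literature.MathematicalPhysics.QuantumFieldTheory.Balaban1983to89.B9Thm34SectBUniform (thm34_Gp_uniform)
open Literature.MathematicalPhysics.QuantumFieldTheory.Balaban1983to89.B9Thm34GKernelFinal (exists_bound_of_continuousAt)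
open Literature.MathematicalPhysics.QuantumFieldTheory.Balaban1983to89.B9Thm34GpKernelFinal (ineq363_kernel_vPrime)

/-! ## (3.65): the remainder `G′(U′U) − G′(U)` in the printed kernel form with the factor `α₁`, `a₁`, `B` chosen before the lattice -/

section FinalU

variable {𝔸 : Type*} [NormedRing 𝔸] [NormedAlgebra ℂ 𝔸] [CompleteSpace 𝔸] {ι : Type} [Fintype ι]
variable (b : Module.Basis ι ℝ 𝔸) (κ : Type) [Fintype κ]

set_option maxHeartbeats 1600000 in
/-- **THE REMAINDERS OF (3.65) «SATISFY THEOREM 3.1 WITH THE ADDITIONAL SMALL FACTOR O(1)α₁» (p. 403, L7–9), PRINTED KERNEL FORM, CONSTANTS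
BEFORE THE LATTICE** («There exists a positive constant a₁ …», p. 400; «the constants … do not depend on the sequence {Ω_j}», p. 399): for fixed
`d`, direction type `κ`, algebra `(𝔸, b)` with real-coordinate constant `M₂`, input constants `δ₀, B_G, C_q, a₀, d₀` and ONE scale-transfer
function `Λ(·) ≧ 1` (p. 398 / [4] Lemma 2.1), THERE EXIST `a₁ > 0` and `B ≧ 0` such that FOR EVERY lattice `(S, T)`, multiscale geometry `𝔅 = g`
with block map `blk` (axioms, [4] (2.61) at `δ₀` for every exponent, the scale transfer with `Λ(α)` for every exponent), background `U` (unitary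
type, stencil range `d₀`), (3.19)/(3.24)/(3.60) data and `G′(U) = (Δ′_a(U))⁻¹` obeying Theorem 3.1 ((3.42)₁₋₃ as block majorants and (3.42)₁₋₄
as kernel bounds at `(B_G, δ₀)` for the pairing weights `(v, c_K)`): for all `0 ≦ α₁ ≦ a₁`, all `A` in (3.37) (blockwise) and (3.59) kernels,
`G′(U)V′(A)G′(U′U) = G′(U′U) − G′(U) = G′(U′U)V′(A)G′(U)` ((3.65)) and `|(G′(U′U) − G′(U))(x,x′)| ≦ Bα₁(Lʲη)²e^{−(4δ₀/5)d(y,y′)}v(y′)⁻¹`,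
`|(∇_k(G′(U′U) − G′(U)))(x,x′)|, |((G′(U′U) − G′(U))∇*_l)(x,x′)| ≦ Bα₁Lʲη e^{−(4δ₀/5)d}v(y′)⁻¹`, `|(∇_k(G′(U′U) − G′(U))∇*_l)(x,x′)| ≦
Bα₁e^{−(4δ₀/5)d}v(y′)⁻¹` — FILE 32 `remainder365_kernel_final` verbatim, re-quantified.  (`a₁`, `B` = FILE 32's values read at `Λ(1/100)` with
FILE 45's threshold/constant.)
[cite: Balaban1985BackgroundPropagators, p.403 + (3.65) p.402 + (3.63) p.402 + Thm 3.1 (3.42) p.397 + Thm 3.4 p.400 + p.399 + p.398 remark + (3.19) p.393 + (3.24) p.394 + (3.59)–(3.60) p.402 + (3.37) p.396; Balaban1984PropagatorsII, Lemma 2.1 p.234 + (2.51)–(2.55) p.232 + (2.66) p.234] -/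
theorem remainder365_kernel_uniform [DecidableEq ι] (d : ℕ)
    (δ₀ BG Cq a₀ d₀ M₂ : ℝ) (Λf : ℝ → ℝ)
    (hBG : 0 < BG) (hCq : 0 ≤ Cq) (ha₀ : 0 ≤ a₀) (hM₂ : 0 ≤ M₂) (hδ₀ : 0 < δ₀) (hΛf : ∀ α : ℝ, 0 < α → 1 ≤ Λf α)
    (hrepr : ∀ (v : 𝔸) (i : ι), |b.repr v i| ≤ M₂ * ‖v‖) :
    ∃ a₁ : ℝ, 0 < a₁ ∧ ∃ B : ℝ, 0 ≤ B ∧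
    ∀ {S : Type} [Fintype S] [DecidableEq S] (T : κ → Equiv.Perm S) (U : κ → S → 𝔸ˣ)
      {g : B9.Geometry} [Fintype g.Site] [DecidableEq g.Site] [Nonempty g.Site] {Rr : ℝ} {H : Prop} (blk : S → g.Site)
      (kQ : g.Site → S → 𝔸 →L[ℝ] 𝔸) (sQ : S → 𝔸 →L[ℝ] 𝔸) (cfun w : g.Site → ℝ)
    -- the multiscale geometry 𝔅 (p. 393, [4] (2.1)–(2.4)) and its axioms
    (hdnn : ∀ a a' : g.Site, 0 ≤ g.dist a a') (htri : Triangle254 (toB6 g Rr H)) (hrefl : ∀ y : g.Site, g.dist y y = 0)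
    (hsym : ∀ y y' : g.Site, g.dist y y' = g.dist y' y) (hlen : ∀ y : g.Site, 0 < g.len y) (hlenη : ∀ y : g.Site, g.eta ≤ g.len y)
    (hη : 0 < g.eta)
    -- [4] Lemma 2.1 (2.61) at the rate `δ₀`, «for every 0 < α < 1», and the p. 398 scale transfer for every exponent
    (h261 : ∀ α : ℝ, 0 < α → α < 1 → Ineq261 d (toB6 g Rr H) δ₀ α)
      (hST : ∀ α : ℝ, 0 < α → ScaleTransfer g δ₀ α (Λf α) (fun a => g.len a) ∧ ScaleTransfer g δ₀ α (Λf α) (fun a => g.len a ^ 2) ∧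
        ScaleTransfer g δ₀ α (Λf α) (fun a => (g.len a)⁻¹) ∧ ScaleTransfer g δ₀ α (Λf α) (fun a => (g.len a ^ 2)⁻¹) ∧
        ScaleTransfer g δ₀ α (Λf α) (fun a => (g.len a ^ 4)⁻¹) ∧ ScaleTransfer g δ₀ α (Λf α) (fun y => g.len y ^ (-(4 : ℝ))))
    (hU1 : ∀ m z, ‖((U m z : 𝔸ˣ) : 𝔸)‖ ≤ 1 ∧ ‖(((U m z)⁻¹ : 𝔸ˣ) : 𝔸)‖ ≤ 1)
    (hd₀B : ∀ μ x, g.dist (blk x) (blk ((T μ).symm x)) ≤ d₀) (hd₀F : ∀ μ x, g.dist (blk x) (blk (T μ x)) ≤ d₀)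
    (hd₀0 : ∀ y : g.Site, g.dist y y ≤ d₀)
    -- the `A`-independent data of the concrete `V′(A)` of (3.60)
    (hw : ∀ y, 0 ≤ w y) (hcard : ∀ y, ((B9Eq360Vprime.block blk y).card : ℝ) * w y ≤ 1)
    (hkQ : ∀ y x, blk x = y → ‖kQ y x‖ ≤ w y) (hsQ : ∀ x, ‖sQ x‖ ≤ 1) (hcfun : ∀ y, |cfun y| ≤ a₀ * (g.len y ^ 2)⁻¹)
    -- THEOREM 3.1 for `G′(U)`: (3.24) `G′(U) = (Δ′_a(U))⁻¹` for the letter `Δ′_a(U)`, and (3.42)₁,₂,₃ at the rate `δ₀`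
    {Δp Gp : Module.End ℝ (S × ι → ℝ)} (hΔpGp : Δp * Gp = 1) (hGpΔp : Gp * Δp = 1)
    (h342_1 : HasMajorant (g := toB6 g Rr H) (fun p : S × ι => blk p.1) Gp
      (fun a a' => BG * g.len a ^ 2 * Real.exp (-(δ₀ * g.dist a a'))))
    (h342_2 : ∀ k : κ ⊕ κ, HasMajorant (g := toB6 g Rr H) (fun p : S × ι => blk p.1)
      (conj b (diffLetter T U ((g.eta : ℂ)⁻¹) k) * Gp) (fun a a' => BG * g.len a * Real.exp (-(δ₀ * g.dist a a'))))
    (h342_3 : ∀ k : κ ⊕ κ, HasMajorant (g := toB6 g Rr H) (fun p : S × ι => blk p.1)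
      (Gp * conj b (diffLetter T U ((g.eta : ℂ)⁻¹) k)) (fun a a' => BG * g.len a * Real.exp (-(δ₀ * g.dist a a'))))
    -- the kernel pairing of p. 393 (`c = η^d`, block volume weight `v(y′) = (L^{j′}η)^d`) and THEOREM 3.1's (3.42)₁₋₄ FOR `G′(U)` IN THE PRINTED KERNEL FORM
    {v : g.Site → ℝ} (hv : ∀ y, 0 < v y) {cK : ℝ} (hcK : 0 < cK)
    (hGpk : HasKernelBound (g := toB6 g Rr H) (fun p : S × ι => blk p.1) v cK Gp
      (fun a a' => BG * g.len a ^ 2 * Real.exp (-(δ₀ * g.dist a a'))))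
    (hDGpk : ∀ k : κ ⊕ κ, HasKernelBound (g := toB6 g Rr H) (fun p : S × ι => blk p.1) v cK
      (conj b (diffLetter T U ((g.eta : ℂ)⁻¹) k) * Gp) (fun a a' => BG * g.len a * Real.exp (-(δ₀ * g.dist a a'))))
    (hGpDk : ∀ l : κ ⊕ κ, HasKernelBound (g := toB6 g Rr H) (fun p : S × ι => blk p.1) v cK
      (Gp * conj b (diffLetter T U ((g.eta : ℂ)⁻¹) l)) (fun a a' => BG * g.len a * Real.exp (-(δ₀ * g.dist a a'))))
    (hDGpDk : ∀ k l : κ ⊕ κ, HasKernelBound (g := toB6 g Rr H) (fun p : S × ι => blk p.1) v cK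
      (conj b (diffLetter T U ((g.eta : ℂ)⁻¹) k) * Gp * conj b (diffLetter T U ((g.eta : ℂ)⁻¹) l)) (fun a a' => BG * Real.exp (-(δ₀ * g.dist a a')))),
    ∀ (α₁ : ℝ), 0 ≤ α₁ → α₁ ≤ a₁ →
    -- the exponent field `A` in the domain (3.37), read blockwise, and the `A`-dependent (3.59) data `kF`, `sF`
    ∀ (A : κ → S → 𝔸) (kF : g.Site → S → 𝔸 →L[ℝ] 𝔸) (sF : S → 𝔸 →L[ℝ] 𝔸),
      (∀ y x, blk x = y → ‖kF y x‖ ≤ Cq * α₁ * w y) → (∀ x, ‖sF x‖ ≤ Cq * α₁) →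
      (∀ ν k x, ‖((g.eta : ℂ)⁻¹) • covDstar T U ν (A k) x‖ ≤ α₁ * (g.len (blk x) ^ 2)⁻¹) →
      (∀ μ ν x, ‖((g.eta : ℂ)⁻¹) • covD T U μ (A ν) x‖ ≤ α₁ * (g.len (blk x) ^ 2)⁻¹) →
      (∀ μ x, ‖((g.eta : ℂ)⁻¹) • covDstar T U μ (tauB T U μ (A μ)) x‖ ≤ α₁ * (g.len (blk x) ^ 2)⁻¹) →
      (∀ k x, ‖A k x‖ ≤ α₁ * (g.len (blk x))⁻¹) → (∀ ν k x, ‖tauB T U ν (A k) x‖ ≤ α₁ * (g.len (blk x))⁻¹) →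
      -- (3.65): the two printed remainders `G′(U)V′(A)G′(U′U)` and `G′(U′U)V′(A)G′(U)` are the one operator `G′(U′U) − G′(U)`
      Gp * conj b (vPrimeConc T U g.eta A blk kQ kF sQ sF cfun) * (gPrimeExtEnd Gp (conj b (vPrimeConc T U g.eta A blk kQ kF sQ sF cfun) * Gp)) = gPrimeExtEnd Gp (conj b (vPrimeConc T U g.eta A blk kQ kF sQ sF cfun) * Gp) - Gp ∧
      (gPrimeExtEnd Gp (conj b (vPrimeConc T U g.eta A blk kQ kF sQ sF cfun) * Gp)) * conj b (vPrimeConc T U g.eta A blk kQ kF sQ sF cfun) * Gp = gPrimeExtEnd Gp (conj b (vPrimeConc T U g.eta A blk kQ kF sQ sF cfun) * Gp) - Gp ∧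
      -- «They satisfy Theorem 3.1 with the additional small factor O(1)α₁»: the four (3.42) entries in the printed kernel form
      HasKernelBound (g := toB6 g Rr H) (fun p : S × ι => blk p.1) v cK (gPrimeExtEnd Gp (conj b (vPrimeConc T U g.eta A blk kQ kF sQ sF cfun) * Gp) - Gp)
        (fun a a' => B * α₁ * g.len a ^ 2 * Real.exp (-(4 / 5 * δ₀ * g.dist a a'))) ∧
      (∀ k : κ ⊕ κ, HasKernelBound (g := toB6 g Rr H) (fun p : S × ι => blk p.1) v cK (conj b (diffLetter T U ((g.eta : ℂ)⁻¹) k) * (gPrimeExtEnd Gp (conj b (vPrimeConc T U g.eta A blk kQ kF sQ sF cfun) * Gp) - Gp))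
        (fun a a' => B * α₁ * g.len a * Real.exp (-(4 / 5 * δ₀ * g.dist a a')))) ∧
      (∀ l : κ ⊕ κ, HasKernelBound (g := toB6 g Rr H) (fun p : S × ι => blk p.1) v cK ((gPrimeExtEnd Gp (conj b (vPrimeConc T U g.eta A blk kQ kF sQ sF cfun) * Gp) - Gp) * conj b (diffLetter T U ((g.eta : ℂ)⁻¹) l))
        (fun a a' => B * α₁ * g.len a * Real.exp (-(4 / 5 * δ₀ * g.dist a a')))) ∧
      (∀ k l : κ ⊕ κ, HasKernelBound (g := toB6 g Rr H) (fun p : S × ι => blk p.1) v cK (conj b (diffLetter T U ((g.eta : ℂ)⁻¹) k) * (gPrimeExtEnd Gp (conj b (vPrimeConc T U g.eta A blk kQ kF sQ sF cfun) * Gp) - Gp) * conj b (diffLetter T U ((g.eta : ℂ)⁻¹) l))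
        (fun a a' => B * α₁ * Real.exp (-(4 / 5 * δ₀ * g.dist a a')))) := by
  classical
  -- the scale-transfer constant of the chain, READ FROM THE GIVEN FUNCTION `Λf` (lattice-free), and [4] Lemma 2.1's `c₁ ≧ 0`
  have hΛ1 : 1 ≤ Λf (1 / 100) := hΛf _ (by norm_num)
  have hΛ0 : 0 ≤ Λf (1 / 100) := zero_le_one.trans hΛ1
  have hc1 : 0 ≤ B6.c1 d δ₀ (1 / 100) := B6RandomWalk.c1_nonneg d δ₀ (1 / 100)
  -- FILE 45: thresholds, the constant `B`, the two inverse identities and the universal left block-majorant clause for `E = G′(U′U)` — BEFORE THE LATTICE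
  obtain ⟨a₁, ha₁, B, hB, hfin⟩ := thm34_Gp_uniform b κ d δ₀ BG Cq a₀ d₀ M₂ Λf hBG hCq ha₀ hM₂ hδ₀ hΛf hrepr
  -- «the additional small factor O(1)α₁» (p. 403): `θ₃₆₃(α₁) = κ(α₁)·α₁` with `κ` continuous in `α₁`, hence `κ ≦ K` below a threshold `ε`
  obtain ⟨K, ε, hK, hε, hKb⟩ := exists_bound_of_continuousAt
    (f := fun α₁ : ℝ => kappa385 BG (cVConc (Fintype.card κ) 1 α₁ a₀ Cq M₂ (∑ i, ‖b i‖) (Real.exp (δ₀ * d₀))) 0 0 (Λf (1 / 100)) (B6.c1 d δ₀ (1 / 100)))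
    (by unfold kappa385 cVConc cBConc; fun_prop)
  have hB' : 0 ≤ B * K * (Λf (1 / 100)) * B6.c1 d δ₀ (1 / 100) := mul_nonneg (mul_nonneg (mul_nonneg hB hK) hΛ0) hc1
  refine ⟨min a₁ (min (ε / 2) (1 / 4)), lt_min ha₁ (lt_min (half_pos hε) (by norm_num)), B * K * (Λf (1 / 100)) * B6.c1 d δ₀ (1 / 100), hB', ?_⟩
  -- NOW the lattice, the background, the (3.19)/(3.24)/(3.60) data, Theorem 3.1 for `U` (block and kernel members); then `α₁`, `A`
  intro S _ _ T U g _ _ _ Rr H blk kQ sQ cfun w hdnn htri hrefl hsym hlen hlenη hη h261 hST hU1 hd₀B hd₀F hd₀0 hw hcard hkQ hsQ hcfun Δp Gp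
    hΔpGp hGpΔp h342_1 h342_2 h342_3 v hv cK hcK hGpk hDGpk hGpDk hDGpDk α₁ hα₁0 hα₁1 A kF sF hkF hsF h337B h337F h337Bτ hA hAτB
  replace hfin := hfin T U blk kQ sQ cfun w hdnn htri hrefl hsym hlen hlenη hη h261 hST hU1 hd₀B hd₀F hd₀0 hw hcard hkQ hsQ hcfun hΔpGp
    hGpΔp h342_1 h342_2 h342_3
  -- the p. 398 scale transfers and [4] Lemma 2.1 at exponent `1/100`
  obtain ⟨hT1, hT2, hT1i, -, -, -⟩ := hST (1 / 100) (by norm_num)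
  have h261β : Ineq261 d (toB6 g Rr H) δ₀ (1 / 100) := h261 _ (by norm_num) (by norm_num)
  have hα₁a : α₁ ≤ a₁ := hα₁1.trans (min_le_left _ _)
  have hα₁ε : α₁ ≤ ε / 2 := hα₁1.trans ((min_le_right _ _).trans (min_le_left _ _))
  have hα₁q : α₁ ≤ 1 / 4 := hα₁1.trans ((min_le_right _ _).trans (min_le_right _ _))
  obtain ⟨i1, i2, hL, -⟩ := hfin α₁ hα₁0 hα₁a A kF sF hkF hsF h337B h337F h337Bτ hA hAτB
  have hKα : 0 ≤ K * α₁ := mul_nonneg hK hα₁0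
  have hθK : theta363 (Fintype.card κ) 1 α₁ a₀ Cq M₂ (∑ i, ‖b i‖) (Real.exp (δ₀ * d₀)) BG (Λf (1 / 100)) (B6.c1 d δ₀ (1 / 100)) ≤ K * α₁ := by
    change kappa385 BG (cVConc (Fintype.card κ) 1 α₁ a₀ Cq M₂ (∑ i, ‖b i‖) (Real.exp (δ₀ * d₀))) 0 0 (Λf (1 / 100)) (B6.c1 d δ₀ (1 / 100)) * α₁ ≤ K * α₁
    exact mul_le_mul_of_nonneg_right (hKb α₁ (by rw [abs_of_nonneg hα₁0]; linarith)) hα₁0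
  -- (3.65): BOTH remainders equal `E − G′(U)` — from `Δ′_a(U)G′(U) = 1 = G′(U)Δ′_a(U)` and the two inverse identities of `E`
  have h365 : gPrimeExtEnd Gp (conj b (vPrimeConc T U g.eta A blk kQ kF sQ sF cfun) * Gp) = Gp + (gPrimeExtEnd Gp (conj b (vPrimeConc T U g.eta A blk kQ kF sQ sF cfun) * Gp)) * (conj b (vPrimeConc T U g.eta A blk kQ kF sQ sF cfun) * Gp) :=
    eq386_resolvent_of_inverses (Δ := Δp) (Δ' := Δp - conj b (vPrimeConc T U g.eta A blk kQ kF sQ sF cfun)) (V := conj b (vPrimeConc T U g.eta A blk kQ kF sQ sF cfun)) hΔpGp i2 rfl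
  have hR : (gPrimeExtEnd Gp (conj b (vPrimeConc T U g.eta A blk kQ kF sQ sF cfun) * Gp)) * (conj b (vPrimeConc T U g.eta A blk kQ kF sQ sF cfun) * Gp) = gPrimeExtEnd Gp (conj b (vPrimeConc T U g.eta A blk kQ kF sQ sF cfun) * Gp) - Gp := by
    rw [eq_sub_iff_add_eq]; exact (add_comm _ _).trans h365.symm
  have hLft : Gp * (conj b (vPrimeConc T U g.eta A blk kQ kF sQ sF cfun) * (gPrimeExtEnd Gp (conj b (vPrimeConc T U g.eta A blk kQ kF sQ sF cfun) * Gp))) = gPrimeExtEnd Gp (conj b (vPrimeConc T U g.eta A blk kQ kF sQ sF cfun) * Gp) - Gp := by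
    have h1 : Gp * ((Δp - conj b (vPrimeConc T U g.eta A blk kQ kF sQ sF cfun)) * (gPrimeExtEnd Gp (conj b (vPrimeConc T U g.eta A blk kQ kF sQ sF cfun) * Gp))) = Gp := by rw [i1, mul_one]
    have h2 : Gp * ((Δp - conj b (vPrimeConc T U g.eta A blk kQ kF sQ sF cfun)) * (gPrimeExtEnd Gp (conj b (vPrimeConc T U g.eta A blk kQ kF sQ sF cfun) * Gp))) = gPrimeExtEnd Gp (conj b (vPrimeConc T U g.eta A blk kQ kF sQ sF cfun) * Gp) - Gp * (conj b (vPrimeConc T U g.eta A blk kQ kF sQ sF cfun) * (gPrimeExtEnd Gp (conj b (vPrimeConc T U g.eta A blk kQ kF sQ sF cfun) * Gp))) := by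
      rw [sub_mul, mul_sub, ← mul_assoc Gp Δp, hGpΔp, one_mul]
    have h3 : gPrimeExtEnd Gp (conj b (vPrimeConc T U g.eta A blk kQ kF sQ sF cfun) * Gp) - Gp * (conj b (vPrimeConc T U g.eta A blk kQ kF sQ sF cfun) * (gPrimeExtEnd Gp (conj b (vPrimeConc T U g.eta A blk kQ kF sQ sF cfun) * Gp))) = Gp := h2.symm.trans h1
    calc Gp * (conj b (vPrimeConc T U g.eta A blk kQ kF sQ sF cfun) * (gPrimeExtEnd Gp (conj b (vPrimeConc T U g.eta A blk kQ kF sQ sF cfun) * Gp))) = gPrimeExtEnd Gp (conj b (vPrimeConc T U g.eta A blk kQ kF sQ sF cfun) * Gp) - (gPrimeExtEnd Gp (conj b (vPrimeConc T U g.eta A blk kQ kF sQ sF cfun) * Gp) - Gp * (conj b (vPrimeConc T U g.eta A blk kQ kF sQ sF cfun) * (gPrimeExtEnd Gp (conj b (vPrimeConc T U g.eta A blk kQ kF sQ sF cfun) * Gp)))) := (sub_sub_cancel _ _).symm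
      _ = gPrimeExtEnd Gp (conj b (vPrimeConc T U g.eta A blk kQ kF sQ sF cfun) * Gp) - Gp := by rw [h3]
  -- the four words `X·(E − G′(U))·Y = (X·E)·(V′(A)·(G′(U)·Y))`
  have hop11 : gPrimeExtEnd Gp (conj b (vPrimeConc T U g.eta A blk kQ kF sQ sF cfun) * Gp) - Gp = (gPrimeExtEnd Gp (conj b (vPrimeConc T U g.eta A blk kQ kF sQ sF cfun) * Gp)) * (conj b (vPrimeConc T U g.eta A blk kQ kF sQ sF cfun) * Gp) := hR.symm
  have hopk1 : ∀ k : κ ⊕ κ, conj b (diffLetter T U ((g.eta : ℂ)⁻¹) k) * (gPrimeExtEnd Gp (conj b (vPrimeConc T U g.eta A blk kQ kF sQ sF cfun) * Gp) - Gp) = conj b (diffLetter T U ((g.eta : ℂ)⁻¹) k) * (gPrimeExtEnd Gp (conj b (vPrimeConc T U g.eta A blk kQ kF sQ sF cfun) * Gp)) * (conj b (vPrimeConc T U g.eta A blk kQ kF sQ sF cfun) * Gp) := fun k => by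
    rw [← hR]; simp only [mul_assoc]
  have hop1l : ∀ l : κ ⊕ κ, (gPrimeExtEnd Gp (conj b (vPrimeConc T U g.eta A blk kQ kF sQ sF cfun) * Gp) - Gp) * conj b (diffLetter T U ((g.eta : ℂ)⁻¹) l) = (gPrimeExtEnd Gp (conj b (vPrimeConc T U g.eta A blk kQ kF sQ sF cfun) * Gp)) * (conj b (vPrimeConc T U g.eta A blk kQ kF sQ sF cfun) * (Gp * conj b (diffLetter T U ((g.eta : ℂ)⁻¹) l))) := fun l => by
    rw [← hR]; simp only [mul_assoc]
  have hopkl : ∀ k l : κ ⊕ κ, conj b (diffLetter T U ((g.eta : ℂ)⁻¹) k) * (gPrimeExtEnd Gp (conj b (vPrimeConc T U g.eta A blk kQ kF sQ sF cfun) * Gp) - Gp) * conj b (diffLetter T U ((g.eta : ℂ)⁻¹) l) = conj b (diffLetter T U ((g.eta : ℂ)⁻¹) k) * (gPrimeExtEnd Gp (conj b (vPrimeConc T U g.eta A blk kQ kF sQ sF cfun) * Gp)) * (conj b (vPrimeConc T U g.eta A blk kQ kF sQ sF cfun) * (Gp * conj b (diffLetter T U ((g.eta : ℂ)⁻¹)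 l))) := fun k l => by
    rw [← hR]; simp only [mul_assoc]
  -- the shapes in which FILE 29's §1 reads (3.37), the transports and the stencil geometry
  have hsmall : ∀ y : g.Site, g.eta * (α₁ * (g.len y)⁻¹) ≤ 1 / 4 := fun y => by
    have hq : g.eta * (g.len y)⁻¹ ≤ 1 := by
      rw [← div_eq_mul_inv]; exact (div_le_one (hlen y)).mpr (hlenη y)
    calc g.eta * (α₁ * (g.len y)⁻¹) = α₁ * (g.eta * (g.len y)⁻¹) := by ring
      _ ≤ α₁ * 1 := mul_le_mul_of_nonneg_left hq hα₁0
      _ ≤ 1 / 4 := by linarith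
  have hA' : ∀ μ x, ‖A μ x‖ ≤ α₁ * (g.len (blk x))⁻¹ ∧ ‖tauB T U μ (A μ) x‖ ≤ α₁ * (g.len (blk x))⁻¹ :=
    fun μ x => ⟨hA μ x, hAτB μ μ x⟩
  have h337s' : ∀ μ x, ‖((g.eta : ℂ)⁻¹) • covDstar T U μ (A μ) x‖ ≤ α₁ * (g.len (blk x) ^ 2)⁻¹ := fun μ x => h337B μ μ x
  have hd₀' : ∀ μ x, g.dist (blk x) (blk (T μ x)) ≤ d₀ ∧ g.dist (blk x) (blk ((T μ).symm x)) ≤ d₀ :=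
    fun μ x => ⟨hd₀F μ x, hd₀B μ x⟩
  -- elementary identities for the weights `(Lʲη)², Lʲη, 1, (Lʲη)⁻¹`
  have hl21 : ∀ a : g.Site, g.len a ^ 2 * (g.len a)⁻¹ = g.len a := fun a => by
    rw [pow_two, mul_assoc, mul_inv_cancel₀ (hlen a).ne', mul_one]
  have hl10 : ∀ a : g.Site, g.len a * (g.len a)⁻¹ = 1 := fun a => mul_inv_cancel₀ (hlen a).ne'
  have hl22 : ∀ a : g.Site, (g.len a ^ 2)⁻¹ * g.len a ^ 2 = 1 := fun a => inv_mul_cancel₀ (pow_ne_zero 2 (hlen a).ne')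
  have hl2i1 : ∀ a : g.Site, (g.len a ^ 2)⁻¹ * g.len a = (g.len a)⁻¹ := fun a => by
    rw [pow_two, mul_inv, mul_assoc, inv_mul_cancel₀ (hlen a).ne', mul_one]
  -- scale transfers for the weights `(Lʲη)²·(Lʲη)⁻¹ = Lʲη`, `Lʲη·(Lʲη)⁻¹ = 1` and `1`
  have hSTone : ScaleTransfer g δ₀ (1 / 100) (Λf (1 / 100)) (fun _ : g.Site => (1 : ℝ)) := fun y y' => by
    simp only [mul_one]
    have h0 : 0 ≤ 1 / 100 * δ₀ * g.dist y y' := mul_nonneg (mul_nonneg (by norm_num) hδ₀.le) (hdnn y y')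
    exact (Real.exp_le_one_iff.mpr (by linarith)).trans hΛ1
  have hw21 : (fun a : g.Site => g.len a ^ 2 * (g.len a)⁻¹) = fun a => g.len a := funext hl21
  have hw10 : (fun a : g.Site => g.len a * (g.len a)⁻¹) = fun _ => (1 : ℝ) := funext hl10
  have hT21 : ScaleTransfer g δ₀ (1 / 100) (Λf (1 / 100)) (fun a : g.Site => g.len a ^ 2 * (g.len a)⁻¹) := by rw [hw21]; exact hT1
  have hT10 : ScaleTransfer g δ₀ (1 / 100) (Λf (1 / 100)) (fun a : g.Site => g.len a * (g.len a)⁻¹) := by rw [hw10]; exact hSTone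
  have hρ1 : 49 / 50 * δ₀ + (1 / 100 + 1 / 100) * δ₀ ≤ δ₀ := by linarith
  have hρ10 : 0 ≤ 49 / 50 * δ₀ := by linarith
  -- Theorem 3.1's kernel entries of `G′(U)` in the weight shapes §1 reads
  have hDGpk' : ∀ k : κ ⊕ κ, HasKernelBound (g := toB6 g Rr H) (fun p : S × ι => blk p.1) v cK (conj b (diffLetter T U ((g.eta : ℂ)⁻¹) k) * Gp)
      (fun a a' => BG * (g.len a ^ 2 * (g.len a)⁻¹) * Real.exp (-(δ₀ * g.dist a a'))) := fun k =>
    hasKernelBound_mono (g := toB6 g Rr H) _ hv (hDGpk k) fun a a' => le_of_eq (by rw [hl21])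
  have hDGpDk' : ∀ k l : κ ⊕ κ, HasKernelBound (g := toB6 g Rr H) (fun p : S × ι => blk p.1) v cK (conj b (diffLetter T U ((g.eta : ℂ)⁻¹) k) * Gp * conj b (diffLetter T U ((g.eta : ℂ)⁻¹) l))
      (fun a a' => BG * (g.len a * (g.len a)⁻¹) * Real.exp (-(δ₀ * g.dist a a'))) := fun k l =>
    hasKernelBound_mono (g := toB6 g Rr H) _ hv (hDGpDk k l) fun a a' => le_of_eq (by rw [hl10, mul_one])
  -- FILE 29 §1: (3.63) with the kernel on the right letter, right factors `G′(U)` (`w = (Lʲη)²`) and `G′(U)∇*_l` (`w = Lʲη`), at the rate `49δ₀/50`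
  have k1 : HasKernelBound (g := toB6 g Rr H) (fun p : S × ι => blk p.1) v cK (conj b (vPrimeConc T U g.eta A blk kQ kF sQ sF cfun) * Gp)
      (fun a a' => theta363 (Fintype.card κ) 1 α₁ a₀ Cq M₂ (∑ i, ‖b i‖) (Real.exp (δ₀ * d₀)) BG (Λf (1 / 100)) (B6.c1 d δ₀ (1 / 100)) * ((g.len a ^ 2)⁻¹ * g.len a ^ 2) * Real.exp (-(49 / 50 * δ₀ * g.dist a a'))) :=
    ineq363_kernel_vPrime (Rr := Rr) (H := H) b T U blk d hη A kQ kF sQ sF cfun w 1 d₀ M₂ Cq a₀ δ₀ δ₀ (1 / 100) (1 / 100)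
      (49 / 50 * δ₀) (Λf (1 / 100)) BG α₁ (fun a => g.len a ^ 2) hBG.le hα₁0 hΛ0 hρ10 (by norm_num) (by norm_num) hδ₀.le hδ₀.le hρ1 hdnn htri hlen h261β
      (fun a => sq_nonneg _) hT2 hT21 hM₂ hrepr hsmall hA' h337s' hU1 hd₀' hd₀0 hw hcard hCq ha₀ hkQ hkF hsQ hsF hcfun hv hcK
      (Tr := Gp) hGpk hDGpk'
  have k3 : ∀ l : κ ⊕ κ, HasKernelBound (g := toB6 g Rr H) (fun p : S × ι => blk p.1) v cK (conj b (vPrimeConc T U g.eta A blk kQ kF sQ sF cfun) * (Gp * conj b (diffLetter T U ((g.eta : ℂ)⁻¹) l)))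
      (fun a a' => theta363 (Fintype.card κ) 1 α₁ a₀ Cq M₂ (∑ i, ‖b i‖) (Real.exp (δ₀ * d₀)) BG (Λf (1 / 100)) (B6.c1 d δ₀ (1 / 100)) * ((g.len a ^ 2)⁻¹ * g.len a) * Real.exp (-(49 / 50 * δ₀ * g.dist a a'))) := fun l =>
    ineq363_kernel_vPrime (Rr := Rr) (H := H) b T U blk d hη A kQ kF sQ sF cfun w 1 d₀ M₂ Cq a₀ δ₀ δ₀ (1 / 100) (1 / 100)
      (49 / 50 * δ₀) (Λf (1 / 100)) BG α₁ (fun a => g.len a) hBG.le hα₁0 hΛ0 hρ10 (by norm_num) (by norm_num) hδ₀.le hδ₀.le hρ1 hdnn htri hlen h261β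
      (fun a => (hlen a).le) hT1 hT10 hM₂ hrepr hsmall hA' h337s' hU1 hd₀' hd₀0 hw hcard hCq ha₀ hkQ hkF hsQ hsF hcfun hv hcK
      (Tr := Gp * conj b (diffLetter T U ((g.eta : ℂ)⁻¹) l)) (hGpDk l) (fun k => by simpa only [mul_assoc] using hDGpDk' k l)
  -- … with the constant weakened to `K·α₁` and the rate to `4δ₀/5`
  have hexp : ∀ a a' : g.Site, Real.exp (-(49 / 50 * δ₀ * g.dist a a')) ≤ Real.exp (-(4 / 5 * δ₀ * g.dist a a')) := fun a a' => by
    have h0 : 0 ≤ δ₀ * g.dist a a' := mul_nonneg hδ₀.le (hdnn a a')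
    exact Real.exp_le_exp.mpr (by linarith)
  have k1' : HasKernelBound (g := toB6 g Rr H) (fun p : S × ι => blk p.1) v cK (conj b (vPrimeConc T U g.eta A blk kQ kF sQ sF cfun) * Gp)
      (fun a a' => K * α₁ * (1 : ℝ) * Real.exp (-(4 / 5 * δ₀ * g.dist a a'))) := by
    refine hasKernelBound_mono (g := toB6 g Rr H) _ hv k1 fun a a' => ?_
    rw [hl22, mul_one, mul_one]
    exact mul_le_mul hθK (hexp a a') (Real.exp_pos _).le hKα
  have k3' : ∀ l : κ ⊕ κ, HasKernelBound (g := toB6 g Rr H) (fun p : S × ι => blk p.1) v cK (conj b (vPrimeConc T U g.eta A blk kQ kF sQ sF cfun) * (Gp * conj b (diffLetter T U ((g.eta : ℂ)⁻¹) l)))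
      (fun a a' => K * α₁ * (g.len a)⁻¹ * Real.exp (-(4 / 5 * δ₀ * g.dist a a'))) := fun l => by
    refine hasKernelBound_mono (g := toB6 g Rr H) _ hv (k3 l) fun a a' => ?_
    rw [hl2i1]
    exact mul_le_mul (mul_le_mul_of_nonneg_right hθK (inv_nonneg.mpr (hlen a).le)) (hexp a a') (Real.exp_pos _).le
      (mul_nonneg hKα (inv_nonneg.mpr (hlen a).le))
  -- FILE 26's universal left clause: the block majorants of `E` and `∇_k E` at the rate `9δ₀/10`
  have hX1 : HasMajorant (g := toB6 g Rr H) (fun p : S × ι => blk p.1) (gPrimeExtEnd Gp (conj b (vPrimeConc T U g.eta A blk kQ kF sQ sF cfun) * Gp))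
      (fun a a' => B * g.len a ^ 2 * Real.exp (-(9 / 10 * δ₀ * g.dist a a'))) := by
    simpa only [one_mul] using hL 1 (fun a => g.len a ^ 2) (fun a => sq_nonneg _) (by simpa only [one_mul] using h342_1)
  have hXk : ∀ k : κ ⊕ κ, HasMajorant (g := toB6 g Rr H) (fun p : S × ι => blk p.1) (conj b (diffLetter T U ((g.eta : ℂ)⁻¹) k) * (gPrimeExtEnd Gp (conj b (vPrimeConc T U g.eta A blk kQ kF sQ sF cfun) * Gp)))
      (fun a a' => B * g.len a * Real.exp (-(9 / 10 * δ₀ * g.dist a a'))) := fun k =>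
    hL _ (fun a => g.len a) (fun a => (hlen a).le) (h342_2 k)
  -- rate bookkeeping of the kernel step ([4] (2.52)/(2.55)): `r = 9δ₀/10`, `ρ = 4δ₀/5`, `α = β = 1/100`
  have hr' : 4 / 5 * δ₀ + (1 / 100 + 1 / 100) * δ₀ ≤ 9 / 10 * δ₀ := by linarith
  have hρ0 : 0 ≤ 4 / 5 * δ₀ := by linarith
  refine ⟨by rw [mul_assoc]; exact hLft, by rw [mul_assoc]; exact hR, ?_, fun k => ?_, fun l => ?_, fun k l => ?_⟩
  · -- (3.42)₁: `(X, Y) = (1, 1)`, `P = (Lʲη)²`, `Q = 1`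
    have h := hasKernelBound_comp_decay (R := Rr) (H := H) (fun p : S × ι => blk p.1) d δ₀ (1 / 100) (1 / 100) (4 / 5 * δ₀)
      (9 / 10 * δ₀) (Λf (1 / 100)) B (K * α₁) (fun a => g.len a ^ 2) (fun _ => (1 : ℝ)) (fun a => sq_nonneg _) (fun _ => zero_le_one)
      hΛ0 hB hKα hρ0 hr' hdnn htri hSTone h261β hv hcK hX1 k1'
    rw [← hop11] at h
    exact hasKernelBound_mono (g := toB6 g Rr H) _ hv h fun a a' => le_of_eq (by ring)
  · -- (3.42)₂: `(X, Y) = (∇_k, 1)`, `P = Lʲη`, `Q = 1`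
    have h := hasKernelBound_comp_decay (R := Rr) (H := H) (fun p : S × ι => blk p.1) d δ₀ (1 / 100) (1 / 100) (4 / 5 * δ₀)
      (9 / 10 * δ₀) (Λf (1 / 100)) B (K * α₁) (fun a => g.len a) (fun _ => (1 : ℝ)) (fun a => (hlen a).le) (fun _ => zero_le_one)
      hΛ0 hB hKα hρ0 hr' hdnn htri hSTone h261β hv hcK (hXk k) k1'
    rw [← hopk1 k] at h
    exact hasKernelBound_mono (g := toB6 g Rr H) _ hv h fun a a' => le_of_eq (by ring)
  · -- (3.42)₃: `(X, Y) = (1, ∇*_l)`, `P = (Lʲη)²`, `Q = (Lʲη)⁻¹`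
    have h := hasKernelBound_comp_decay (R := Rr) (H := H) (fun p : S × ι => blk p.1) d δ₀ (1 / 100) (1 / 100) (4 / 5 * δ₀)
      (9 / 10 * δ₀) (Λf (1 / 100)) B (K * α₁) (fun a => g.len a ^ 2) (fun a => (g.len a)⁻¹) (fun a => sq_nonneg _)
      (fun a => inv_nonneg.mpr (hlen a).le) hΛ0 hB hKα hρ0 hr' hdnn htri hT1i h261β hv hcK hX1 (k3' l)
    rw [← hop1l l] at h
    exact hasKernelBound_mono (g := toB6 g Rr H) _ hv h fun a a' => le_of_eq (by rw [hl21 a]; ring)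
  · -- (3.42)₄: `(X, Y) = (∇_k, ∇*_l)`, `P = Lʲη`, `Q = (Lʲη)⁻¹`
    have h := hasKernelBound_comp_decay (R := Rr) (H := H) (fun p : S × ι => blk p.1) d δ₀ (1 / 100) (1 / 100) (4 / 5 * δ₀)
      (9 / 10 * δ₀) (Λf (1 / 100)) B (K * α₁) (fun a => g.len a) (fun a => (g.len a)⁻¹) (fun a => (hlen a).le)
      (fun a => inv_nonneg.mpr (hlen a).le) hΛ0 hB hKα hρ0 hr' hdnn htri hT1i h261β hv hcK (hXk k) (k3' l)
    rw [← hopkl k l] at h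
    exact hasKernelBound_mono (g := toB6 g Rr H) _ hv h fun a a' => le_of_eq (by rw [hl10 a]; ring)

end FinalU

end Literature.MathematicalPhysics.QuantumFieldTheory.Balaban1983to89.B9Eq365RemainderKernelUniform

end
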